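import Summits.BirchSwinnertonDyer.BirchSwinnertonDyer.Theorems.ResidualThetaTransportAtTwoThetaLayerLambdaCongruenceAtTwoCuspSpanEllipticFamilies
import HarnessLib

/-!
# Route `ResidualThetaTransportAtTwo`, cruxes Kan⁺ (stmt-BirchSwinnertonDyer-20688) / 21437, node 27436: the TRIANGLE
# LEMMA — an element of `Γ₀(p)` whose upper-right entry lies in `−⟨4⟩` modulo its lower-right entry behaves like a
# `B₁`-element, and the three-term identity it yields

Cell `bsd-wall`, width seat `bsd-wall-rtt-p3-w2` g4 (2026-08-28). THEOREMS ONLY; `--supports stmt-BirchSwinnertonDyer-20688`;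
BSD is not proved by this. Setting and notation of `…CuspSpanGenerationB1` / `…CuspSpanFourInvariance`: `χ : Γ₀(p) → ZMod 2`
additive, killing the elements of trace `0, ±1, ±2` (`hsmall`) and the elements with lower-right entry `±4^k`, `k ≥ 1`
(`hkill`); `F(u) := χ(β)` for any `β` with upper-right entry `−1` and `d(β) ≡ u`.

* §1 `K(±1)`: `F(1) = F(−1) = 0` (the representatives `±T⁻¹` have trace `±2`), any level.
* §2 uses `chi_eq_of_b_neg_one_of_d_eq_four_pow_mul` (`F(4^k u) = F(u)`, width seat w3 g7, `…CuspSpanEllipticFamilies`).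
* §3 **`chi_eq_of_apply_one_one_dvd_sub_four_pow`** (prime level): if `g = (a b; c d) ∈ Γ₀(p)` and `d ∣ c − 4^k` for some
  `k ≥ 1` (equivalently `b ≡ −4^{−k} (mod d)`), then `χ g = F(d mod p)`: with `δ₃ := (c − 4^k)/d` and the `B₁`-element
  `β₃ = (α₃, −1; pκ₃, δ₃)` the product `g β₃` has lower-right entry `−c + dδ₃ = −4^k` EXACTLY, so `χ g = χ β₃ = F(−4^k/d) = F(d)`.
* §4 **the triangle identity**: for `B₁`-elements `g = (a, −1; c, d)`, `β' = (α', −1; c', d')` the product `g β'` has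
  upper-right entry `n := −a − d'` and lower-right entry `−c + dd'`; whenever §3 applies to `g β'` one gets
  `F(d) + F(d') = F(−c + dd')`, i.e. `F(w) = F(u) + F(w/u)` with `u = d`, `w ≡ dd'`. The sequel `…CuspSpanRuleQ` arranges
  `−c + dd' = −q^t` for an odd prime `q ≠ p` (Hensel + an auxiliary Dirichlet prime), giving the rule for every `w ∈ −⟨q⟩`.

References: [Rademacher1929] §1 (generators of `Γ₀(p)`); [Knapp1993] Prop. 11.1; [Pollack2003] Conj. 6.3.
-/

set_option autoImplicit false
set_option linter.dupNamespace false

open scoped MatrixGroups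

open CongruenceSubgroup

namespace Summit.BirchSwinnertonDyer.BirchSwinnertonDyer.Theorems.SignedMuAtTwo

/-! ## §1. `F(±1) = 0` at any level -/

section AnyLevel

variable {N : ℕ} {χ : Gamma0 N → ZMod 2}

/-- `K(1)`: `χ` kills every `b = −1` element with `d ≡ 1 (mod N)` (the representative `(1, −1; 0, 1) = T⁻¹` has trace `2`).
[folklore] -/
theorem chi_eq_zero_of_b_neg_one_of_d_one
    (hadd : ∀ γ δ : Gamma0 N, χ (γ * δ) = χ γ + χ δ)
    (hsmall : ∀ γ : Gamma0 N, ((γ : SL(2, ℤ)) 0 0 + (γ : SL(2, ℤ)) 1 1).natAbs ≤ 2 → χ γ = 0) :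
    ∀ β : Gamma0 N, (β : SL(2, ℤ)) 0 1 = -1 → ((((β : SL(2, ℤ)) 1 1 : ℤ) : ZMod N)) = 1 → χ β = 0 := by
  intro β hb hd
  obtain ⟨T, h00, h01, -, h11⟩ :=
    ThetaLayerLambdaCongruenceAtTwo.exists_gamma0_entries (N := N) 1 (-1) 0 1 (by norm_num) (dvd_zero _)
  have hT : χ T = 0 := hsmall T (by rw [h00, h11]; rfl)
  rw [chi_eq_of_apply_zero_one_eq_neg_one hadd hsmall hb h01 (by rw [hd, h11]; push_cast; rfl), hT]

/-- `K(−1)`: `χ` kills every `b = −1` element with `d ≡ −1 (mod N)` (the representative `(−1, −1; 0, −1) = −T` has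
trace `−2`). [folklore] -/
theorem chi_eq_zero_of_b_neg_one_of_d_neg_one
    (hadd : ∀ γ δ : Gamma0 N, χ (γ * δ) = χ γ + χ δ)
    (hsmall : ∀ γ : Gamma0 N, ((γ : SL(2, ℤ)) 0 0 + (γ : SL(2, ℤ)) 1 1).natAbs ≤ 2 → χ γ = 0) :
    ∀ β : Gamma0 N, (β : SL(2, ℤ)) 0 1 = -1 → ((((β : SL(2, ℤ)) 1 1 : ℤ) : ZMod N)) = -1 → χ β = 0 := by
  intro β hb hd
  obtain ⟨T, h00, h01, -, h11⟩ :=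
    ThetaLayerLambdaCongruenceAtTwo.exists_gamma0_entries (N := N) (-1) (-1) 0 (-1) (by norm_num) (dvd_zero _)
  have hT : χ T = 0 := hsmall T (by rw [h00, h11]; rfl)
  rw [chi_eq_of_apply_zero_one_eq_neg_one hadd hsmall hb h01 (by rw [hd, h11]; push_cast; rfl), hT]

/-- Entries of a product of two `B₁`-elements `g = (a, −1; c, d)`, `β' = (α', −1; c', d')`: upper-right `−a − d'`,
lower-right `−c + d d'`. [folklore] -/
theorem b1_mul_b1_entries {g β' : Gamma0 N} (hg : (g : SL(2, ℤ)) 0 1 = -1) (hβ' : (β' : SL(2, ℤ)) 0 1 = -1) :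
    ((g * β' : Gamma0 N) : SL(2, ℤ)) 0 1 = -(g : SL(2, ℤ)) 0 0 - (β' : SL(2, ℤ)) 1 1 ∧
      ((g * β' : Gamma0 N) : SL(2, ℤ)) 1 1 = -(g : SL(2, ℤ)) 1 0 + (g : SL(2, ℤ)) 1 1 * (β' : SL(2, ℤ)) 1 1 := by
  refine ⟨?_, ?_⟩
  · rw [gamma0_mul_apply_zero_one, hg, hβ']; ring
  · rw [gamma0_mul_apply_one_one', hβ']; ring

end AnyLevel

/-! ## §2–§4. Prime level -/

section PrimeLevel

variable {p : ℕ} [Fact p.Prime] {χ : Gamma0 p → ZMod 2}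

/-- **The `−⟨4⟩` lemma.** At an odd prime level, for `g = (a b; c d) ∈ Γ₀(p)` with `d ∣ c − 4^k` for some `k ≥ 1`
(equivalently `b ≡ −4^{−k} (mod d)`): `χ g = χ β` for every `b = −1` element `β` with `d(β) ≡ d (mod p)`. Indeed with
`δ₃ := (c − 4^k)/d` (prime to `p`) and `β₃ = (α₃, −1; pκ₃, δ₃)`, `g β₃` has lower-right entry `−c + dδ₃ = −4^k`, so
`χ g = χ β₃`, and `d δ₃ ≡ −4^k` gives `χ β₃ = F(−4^k/d) = F(−1/d) = F(d)`. [cite: Rademacher1929, §1]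
[cite: Pollack2003, Conj. 6.3] -/
theorem chi_eq_of_apply_one_one_dvd_sub_four_pow (hp2 : p ≠ 2)
    (hadd : ∀ γ δ : Gamma0 p, χ (γ * δ) = χ γ + χ δ)
    (hsmall : ∀ γ : Gamma0 p, ((γ : SL(2, ℤ)) 0 0 + (γ : SL(2, ℤ)) 1 1).natAbs ≤ 2 → χ γ = 0)
    (hkill : ∀ γ : Gamma0 p, (∃ k : ℕ, 1 ≤ k ∧ ((γ : SL(2, ℤ)) 1 1).natAbs = 4 ^ k) → χ γ = 0)
    (g : Gamma0 p) (k : ℕ) (hk : 1 ≤ k) (hdvd : (g : SL(2, ℤ)) 1 1 ∣ (g : SL(2, ℤ)) 1 0 - 4 ^ k)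
    {β : Gamma0 p} (hb : (β : SL(2, ℤ)) 0 1 = -1)
    (hd : ((((β : SL(2, ℤ)) 1 1 : ℤ) : ZMod p)) = ((((g : SL(2, ℤ)) 1 1 : ℤ) : ZMod p))) : χ g = χ β := by
  have hp : p.Prime := Fact.out
  set c : ℤ := (g : SL(2, ℤ)) 1 0 with hc
  set d : ℤ := (g : SL(2, ℤ)) 1 1 with hdd
  obtain ⟨δ₃, hδ⟩ := hdvd
  -- `c = p c'`
  have hcN : (p : ℤ) ∣ c := by
    have hmem := g.2
    rw [Gamma0_mem] at hmem
    exact (ZMod.intCast_zmod_eq_zero_iff_dvd _ p).mp hmem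
  obtain ⟨c', hc'⟩ := hcN
  -- `δ₃` is prime to `p`: `d δ₃ = −4^k + c' p`
  have h2p : Nat.Coprime 2 p := (Nat.coprime_primes Nat.prime_two hp).mpr (Ne.symm hp2)
  have hcop4 : IsCoprime ((4 : ℤ) ^ k) p := by
    apply IsCoprime.pow_left
    rw [show (4 : ℤ) = ((4 : ℕ) : ℤ) by norm_num, Nat.isCoprime_iff_coprime]
    simpa using h2p.pow_left 2
  have hdδ : d * δ₃ = -4 ^ k + c' * p := by linear_combination -hδ + hc'
  have hcopδ : IsCoprime δ₃ (p : ℤ) := by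
    have e1 : IsCoprime (d * δ₃) p := by rw [hdδ]; exact (hcop4.neg_left).add_mul_right_left c'
    exact e1.of_mul_left_right
  obtain ⟨α₃, κ₃, h3⟩ := hcopδ
  obtain ⟨β₃, -, h301, -, h311⟩ := ThetaLayerLambdaCongruenceAtTwo.exists_gamma0_entries (N := p)
    α₃ (-1) (p * κ₃) δ₃ (by linear_combination h3) (dvd_mul_right _ _)
  -- `g β₃` has lower-right entry `−4^k`
  have hprod : ((g * β₃ : Gamma0 p) : SL(2, ℤ)) 1 1 = -4 ^ k := by
    rw [gamma0_mul_apply_one_one', h301, h311]; linear_combination (-1 : ℤ) * hδ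
  have hkilled : χ (g * β₃) = 0 :=
    hkill _ ⟨k, hk, by rw [hprod, Int.natAbs_neg, Int.natAbs_pow]; rfl⟩
  have hg3 : χ g = χ β₃ := by
    rw [hadd] at hkilled
    have e1 : χ g = -χ β₃ := by linear_combination hkilled
    rw [e1, ZMod.neg_eq_self_mod_two]
  -- residues: `d δ₃ ≡ −4^k`, so `δ₃ ≡ 4^k · (−1/d)`
  have hdu : IsUnit ((d : ℤ) : ZMod p) := isUnit_gamma0_apply_one_one g
  have hres : ((d : ℤ) : ZMod p) * ((δ₃ : ℤ) : ZMod p) = -4 ^ k := by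
    have e1 := congrArg (Int.cast : ℤ → ZMod p) hdδ
    push_cast at e1
    rw [e1, ZMod.natCast_self, mul_zero, add_zero]
  obtain ⟨βs, hbs, hds⟩ := exists_b_neg_one_of_isUnit (N := p) (hdu.unit⁻¹).isUnit.neg
  have h31 : ((((β₃ : SL(2, ℤ)) 1 1 : ℤ) : ZMod p)) = 4 ^ k * ((((βs : SL(2, ℤ)) 1 1 : ℤ) : ZMod p)) := by
    rw [h311, hds]
    have e2 : ((δ₃ : ℤ) : ZMod p) = ((δ₃ : ℤ) : ZMod p) * (((d : ℤ) : ZMod p) * ↑(hdu.unit⁻¹)) := by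
      rw [IsUnit.mul_val_inv, mul_one]
    rw [e2, ← mul_assoc, mul_comm ((δ₃ : ℤ) : ZMod p), hres]; ring
  have hs1 : ((((βs : SL(2, ℤ)) 1 1 : ℤ) : ZMod p)) * ((((β : SL(2, ℤ)) 1 1 : ℤ) : ZMod p)) = -1 := by
    rw [hds, hd, neg_mul, IsUnit.val_inv_mul]
  rw [hg3, chi_eq_of_b_neg_one_of_d_eq_four_pow_mul hp2 hadd hsmall hkill k h301 hbs h31,
    chi_eq_of_b_neg_one_of_mul_d_eq_neg_one hadd hsmall hbs hb hs1]

/-- **The triangle identity.** At an odd prime level, for `b = −1` elements `g, β'` of `Γ₀(p)` such that the product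
`g β'` (lower-right entry `D := −c(g) + d(g)d(β')`) satisfies `D ∣ c(gβ') − 4^k` for some `k ≥ 1`, and any `b = −1`
element `β₃` with `d(β₃) ≡ D (mod p)`: `χ g + χ β' = χ β₃` — i.e. `F(d) + F(d') = F(dd')` in residues
(`F(w) = F(u) + F(w/u)`). [cite: Rademacher1929, §1] [cite: Pollack2003, Conj. 6.3] -/
theorem chi_add_chi_eq_of_triangle (hp2 : p ≠ 2)
    (hadd : ∀ γ δ : Gamma0 p, χ (γ * δ) = χ γ + χ δ)
    (hsmall : ∀ γ : Gamma0 p, ((γ : SL(2, ℤ)) 0 0 + (γ : SL(2, ℤ)) 1 1).natAbs ≤ 2 → χ γ = 0)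
    (hkill : ∀ γ : Gamma0 p, (∃ k : ℕ, 1 ≤ k ∧ ((γ : SL(2, ℤ)) 1 1).natAbs = 4 ^ k) → χ γ = 0)
    (g β' : Gamma0 p) (k : ℕ) (hk : 1 ≤ k)
    (hdvd : ((g * β' : Gamma0 p) : SL(2, ℤ)) 1 1 ∣ ((g * β' : Gamma0 p) : SL(2, ℤ)) 1 0 - 4 ^ k)
    {β₃ : Gamma0 p} (hb₃ : (β₃ : SL(2, ℤ)) 0 1 = -1)
    (hd₃ : ((((β₃ : SL(2, ℤ)) 1 1 : ℤ) : ZMod p)) = ((((g * β' : Gamma0 p) : SL(2, ℤ)) 1 1 : ℤ) : ZMod p)) :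
    χ g + χ β' = χ β₃ := by
  rw [← hadd]
  exact chi_eq_of_apply_one_one_dvd_sub_four_pow hp2 hadd hsmall hkill (g * β') k hk hdvd hb₃ hd₃

end PrimeLevel

end Summit.BirchSwinnertonDyer.BirchSwinnertonDyer.Theorems.SignedMuAtTwo
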